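import Literature.Barriers.ValiantsHypothesis.NotViaSaturationsChow
import Literature.Computability.AlgebraicComplexity.MultiplicityObstructionsProofs
import Literature.Computability.AlgebraicComplexity.OrbitClosureProofs
import HarnessLib

/-!
# Not via saturations — `S(Chow_n) ⊆ S(Det_n)` discharged (BHI 2017, §3)

Sibling proof file (D-0014) of `NotViaSaturationsChow.lean`: it proves the named fact
`Literature.Barriers.ValiantsHypothesis.BHI2017_chow_le_det` (`BHI2017_chow_le_det_holds`), the
first of the two ingredients into which that file decomposes Bürgisser–Hüttenhain–Ikenmeyer's
Theorem 1 (`BHI2017_thm1`, the barrier fact `NotViaSaturations`); consequently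
`BHI2017_thm1_of_thm3 : BHI2017_thm3 → BHI2017_thm1` — the barrier rests on BHI's Theorem 3
(the saturation of the Chow monoid) alone. No statement of the tree is changed; the auxiliary
definitions (`upperBlock`, `degIdxMap`, `lastRow`, `diagToLastRow`) are proof devices.

Source: P. Bürgisser, J. Hüttenhain, C. Ikenmeyer, *Permanent versus determinant: not via
saturations*, Proc. AMS 145 (2017) = arXiv:1501.05528, §3 (p. 6 of the held text): "When we
identify `X_i` with the variable `X_{ii}`, then `Chow_n` is contained in the `Gl_{n²}`-orbit
closure `Det_n`. Indeed, let `ε ∈ ℂ^*`. The linear substitution `X_{ii} ↦ X_{ii}`,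
`X_{ij} ↦ εX_{ij}` for `i ≠ j`, maps `det_n` to `X_{11}⋯X_{nn} + εp` for some polynomial `p`. We
obtain `X_{11}⋯X_{nn}` in the limit when `ε` goes to zero. The basic strategy, as in Kumar
[kumar:13], is to replace `Det_n` by the considerably simpler `Chow_n` and to exhibit elements in
the monoid of representations of the latter. More specifically, we have `S(Chow_n) ⊆ S(Det_n)`",
together with §1 (2) ("let `Z'` be a closed `G`-invariant subset of `Z`. The restriction from `Z`
to `Z'` provides a surjective `G`-invariant ring morphism `𝒪(Z) → 𝒪(Z')`. Hence Schur's lemma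
implies that `S(Z') ⊆ S(Z)`").

## The proof formalised here

The printed sentence hides a change of groups: `S(Chow_n)` is a set of weights of `GL_n` acting
on `Sym^n ℂ^n`, `S(Det_n)` of weights of `GL_{n²}` acting on `Sym^n ℂ^{n²}`. With the tree's
conventions (`OccurrenceObstructionsBIP.lean`: occurrence of `λ` in `ℂ[Ω_m]` is a nonzero
highest-weight vector of the DUAL weight placed on the GREATEST matrix positions, upper triangular
Borel for the lexicographic order on `MatIdx m = Fin m ×ₗ Fin m`) the `m` letters of `GL_m` must
be identified with the last row `(m-1, 0), …, (m-1, m-1)` of the matrix (`lastRow`, an order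
embedding onto an upper set), not with the diagonal; up to the `GL_{m²}`-action this is the same
identification. Steps 1, 2, 4 are carried out for an arbitrary strictly monotone
`ι : σ → τ` onto an upper set of letters (section `UpperEmbedding`,
`hasHighestWeight_orbitCoordRep_extend`), step 3 for `ι = lastRow`. Then:

1. (*complete reducibility*, §1 (2) "Schur's lemma") a weight `χ` occurring in
   `k[Chow_m] = k[Sym^m k^m] ⧸ I(GL_m · w_m)` has an honest highest-weight vector
   `F ∈ k[Sym^m k^m]` outside `I(GL_m · w_m)` (`exists_mem_highestWeightSpace_not_mem`, from the
   tree's `isSemisimpleRepresentation_coordRep` and `map_highestWeightSpace_eq_of_surjective`,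
   characteristic zero);
2. (*inheritance*) `F` renamed to the last-row monomials is a highest-weight vector of
   `k[Sym^m k^{m×m}]` for `GL_{m²}` of weight `χ` extended by zero
   (`rename_mem_highestWeightSpace_coordRep`): an upper triangular `b ∈ GL_{m²}` acts on the
   renamed coordinate functions through its last-row block `b_L ∈ GL_m` (`upperBlock`,
   `coordSubst_rename_degIdxMap`), because an upper triangular substitution maps the
   variables off the last row into themselves (`killCompl_linSubst`);
3. (*`Chow_m ⊆ Det_m`*) for every `g ∈ Mat_m(k)` the product of linear forms `ι(g · w_m)` is the
   degeneration `diagToLastRow g · det_m` (determinant of a diagonal matrix of linear forms,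
   `linSubst_diagToLastRow_detFormLex`), hence lies in `Ω_m` over an infinite field
   (`endOrbit_subset_orbitClosure_holds`) — BHI's `ε → 0` limit replaced by the tree's
   "`End · f ⊆ \overline{GL · f}`";
4. (*restriction*) the renamed `F` does not vanish at such a point, at which the vanishing ideal
   of `GL_{m²} · det_m` vanishes (`mem_orbitClosure_iff_formCoeff_holds`), so it lies outside that
   ideal (`rename_not_mem_orbitVanishingIdeal`) and its class is a nonzero highest-weight vector
   of `k[Ω_m]` (`hasHighestWeight_orbitCoordRep_of_not_mem`);
5. the weight bookkeeping `(padWeight m χ)^* = ` "`χ^*` on the last row"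
   (`toMatIdx_dual_padWeight`) gives `BHI2017_chow_le_det_holds`.

The last section begins the discharge of Prop. 3 ("`S(Chow_n)` generates the group `L`"): the
generation lemma printed at the end of its proof (`bhiLattice_le_of_generators`: `(m,0,…,0)` and
elements `λ^{(k)} ∈ L` with `λ^{(k)}_k = 1`, `λ^{(k)}_i = 0` for `i > k` generate `L`),
`λ^{(1)} = (m,0,…,0) ∈ S(Chow_m)` (`single_zero_mem_chowOccWeights`, the coefficient of `x_{m-1}^m`
at the orbit point `x_{m-1}∏_{i<m-1}(x_i + x_{m-1})`), and the reduction
`BHI2017_prop3_of_generators` of `BHI2017_prop3` to the existence of BHI's `λ^{(2)},…,λ^{(m)}` in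
`A(S(Chow_m))` (Lemma 6 and the plethysm checks, which stay open here).

## References

* [BurgisserHuttenhainIkenmeyer2017] P. Bürgisser, J. Hüttenhain, C. Ikenmeyer, Proc. AMS 145
  (2017) 1247–1258 = arXiv:1501.05528, §1 (2), §3 (Lemma 2, `Chow_n ⊆ Det_n`,
  `S(Chow_n) ⊆ S(Det_n)`, Thm. 3).
* [BurgisserEtAl2011] BLMW, SIAM J. Comput. 40 (2011), §4.4, §5.2 (complete reducibility of
  coordinate rings of orbit closures; tree `Polarization.lean`, `MultiplicityObstructionsProofs.lean`).
* [MulmuleySohoniSIAM2001] K. Mulmuley, M. Sohoni, SIAM J. Comput. 31 (2001), §4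
  (`End · f ⊆ Δ[f]`; tree `OrbitClosureProofs.lean`).

## Mathlib and tree

Mathlib: `MvPolynomial.killCompl` (`killCompl_rename_app`, `coeff_killCompl`,
`killCompl_monomial_mapDomain`, `killCompl_monomial_eq_zero_of_not_subset`), `rename`
(`coeff_rename_mapDomain`, `aeval_rename`), `Finsupp.mapDomain`/`comapDomain`
(`degree_mapDomain`, `mapDomain_comapDomain`), `Matrix.submatrix_one`, `AlgHom.map_det`,
`Matrix.det_diagonal`, `finProdFinEquiv_apply_val`, `Function.extend`. Tree: `coordRep`,
`coordSubst_X`, `orbitVanishingIdeal`, `exists_aeval_formCoeff_ne_zero_of_not_mem`,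
`isSemisimpleRepresentation_coordRep`, `map_highestWeightSpace_eq_of_surjective`,
`mkIntertwiningMap`, `hasHighestWeight_orbitCoordRep_of_not_mem`,
`mem_orbitClosure_iff_formCoeff_holds`, `detFormLex_ne_zero`, `endOrbit_subset_orbitClosure_holds`,
`borelSubgroup`, `weightChar`, `matIdxEquiv`, `detFormLex`/`detPoly`.
-/

noncomputable section

open MvPolynomial

namespace Literature.Barriers.ValiantsHypothesis

open Literature.NumberTheory.DiophantineGeometry Literature.Computability.AlgebraicComplexity
  Literature.Computability.Complexity

/-! ### Inheritance along an order embedding onto an upper set of letters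

Throughout this section `ι : σ → τ` is a strictly monotone map between finite linearly ordered
sets of letters whose range is an upper set of `τ` (the greatest `|σ|` letters). An upper
triangular substitution of the `τ`-variables maps the variables off `range ι` into themselves, so
on polynomials in the degree-`m` coefficients of monomials in the `ι`-variables an upper
triangular `b ∈ GL_τ` acts through its `σ`-block `b|_{ι×ι} ∈ GL_σ`; highest-weight vectors of
`k[Sym^m k^σ]` therefore rename to highest-weight vectors of `k[Sym^m k^τ]` with the weight
extended by zero — the elementary "inheritance principle" (BHI invoke inheritance in the proof of
Lemma 6; here it carries `S(Chow_n)`, weights of `GL_n`, to `S(Det_n)`, weights of `GL_{n²}`). -/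

section UpperEmbedding

variable {k : Type*} [Field k] {σ τ : Type*} [Fintype σ] [LinearOrder σ] [Fintype τ]
  [LinearOrder τ] {ι : σ → τ}

omit [Fintype σ] [LinearOrder σ] [Fintype τ] in
/-- Off the upper set `range ι`, every letter is below every letter of the range. [folklore] -/
theorem lt_app_of_not_mem_range (hup : IsUpperSet (Set.range ι)) {x : τ}
    (hx : x ∉ Set.range ι) (j : σ) : x < ι j :=
  lt_of_not_ge fun h => hx (hup h ⟨j, rfl⟩)

omit [LinearOrder σ] [LinearOrder τ] in
/-- A sum over `τ` of a function vanishing off `range ι` is a sum over `σ`. [folklore] -/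
theorem sum_eq_sum_app (hι : Function.Injective ι) {M : Type*} [AddCommMonoid M] (f : τ → M)
    (hf : ∀ x, x ∉ Set.range ι → f x = 0) : ∑ x, f x = ∑ j : σ, f (ι j) := by
  have h1 : ∑ x ∈ Finset.univ.map ⟨ι, hι⟩, f x = ∑ j : σ, f (ι j) := Finset.sum_map _ _ _
  rw [← h1]
  refine (Finset.sum_subset (Finset.subset_univ _) fun x _ hx => hf x ?_).symm
  rintro ⟨j, rfl⟩
  exact hx (Finset.mem_map.mpr ⟨j, Finset.mem_univ j, rfl⟩)

omit [LinearOrder σ] [LinearOrder τ] in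
/-- The same for products (functions equal to `1` off `range ι`). [folklore] -/
theorem prod_eq_prod_app (hι : Function.Injective ι) {M : Type*} [CommMonoid M] (f : τ → M)
    (hf : ∀ x, x ∉ Set.range ι → f x = 1) : ∏ x, f x = ∏ j : σ, f (ι j) := by
  have h1 : ∏ x ∈ Finset.univ.map ⟨ι, hι⟩, f x = ∏ j : σ, f (ι j) := Finset.prod_map _ _ _
  rw [← h1]
  refine (Finset.prod_subset (Finset.subset_univ _) fun x _ hx => hf x ?_).symm
  rintro ⟨j, rfl⟩
  exact hx (Finset.mem_map.mpr ⟨j, Finset.mem_univ j, rfl⟩)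

omit [Fintype σ] [LinearOrder σ] [Fintype τ] [LinearOrder τ] in
/-- `killCompl` on a variable of the range. [folklore] -/
theorem killCompl_X_app (hι : Function.Injective ι) (j : σ) :
    killCompl (R := k) hι (X (ι j)) = X j := by
  rw [← rename_X ι j, killCompl_rename_app]

omit [Fintype σ] [LinearOrder σ] [Fintype τ] [LinearOrder τ] in
/-- `killCompl` kills the variables off the range. [folklore] -/
theorem killCompl_X_of_not_mem (hι : Function.Injective ι) {x : τ} (hx : x ∉ Set.range ι) :
    killCompl (R := k) hι (X x) = 0 := by
  rw [X, killCompl_monomial_eq_zero_of_notMem_range _ (1 : k) (a := x)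
    (Finsupp.mem_support_iff.mpr (by simp)) hx]

/-- **Killing the variables off an upper set commutes with upper triangular substitutions**: for
an upper triangular matrix `c` on `τ` (entries below the diagonal vanish), killing after
substituting by `c` is substituting by the `σ`-block of `c` after killing. [folklore] -/
theorem killCompl_linSubst (hι : StrictMono ι) (hup : IsUpperSet (Set.range ι))
    (c : Matrix τ τ k) (hc : ∀ x y : τ, y < x → c x y = 0) (p : MvPolynomial τ k) :
    killCompl hι.injective (linSubst τ k c p) =
      linSubst σ k (c.submatrix ι ι) (killCompl hι.injective p) := by
  suffices h : (killCompl hι.injective).comp (linSubst τ k c) =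
      (linSubst σ k (c.submatrix ι ι)).comp (killCompl (R := k) hι.injective) from
    congrArg (fun φ => φ p) h
  apply MvPolynomial.algHom_ext
  intro x
  simp only [AlgHom.comp_apply, linSubst_X, map_sum, map_smul]
  by_cases hx : x ∈ Set.range ι
  · obtain ⟨j, rfl⟩ := hx
    rw [killCompl_X_app, linSubst_X]
    rw [sum_eq_sum_app hι.injective _ fun y hy => by
      rw [killCompl_X_of_not_mem hι.injective hy, smul_zero]]
    refine Finset.sum_congr rfl fun l _ => ?_
    rw [killCompl_X_app, Matrix.submatrix_apply]
  · rw [killCompl_X_of_not_mem hι.injective hx, map_zero]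
    refine Finset.sum_eq_zero fun y _ => ?_
    by_cases hy : y ∈ Set.range ι
    · obtain ⟨l, rfl⟩ := hy
      rw [hc _ _ (lt_app_of_not_mem_range hup hx l), zero_smul]
    · rw [killCompl_X_of_not_mem hι.injective hy, smul_zero]

/-- For an upper triangular `b`, the `σ`-block of `b c` is the product of the `σ`-blocks.
[folklore] -/
theorem submatrix_mul_of_upper (hι : StrictMono ι) (hup : IsUpperSet (Set.range ι))
    {b : Matrix τ τ k} (hb : ∀ x y : τ, y < x → b x y = 0) (c : Matrix τ τ k) :
    b.submatrix ι ι * c.submatrix ι ι = (b * c).submatrix ι ι := by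
  ext i j
  simp only [Matrix.mul_apply, Matrix.submatrix_apply]
  rw [sum_eq_sum_app hι.injective (fun x => b (ι i) x * c x (ι j)) fun x hx => by
    rw [hb _ _ (lt_app_of_not_mem_range hup hx i), zero_mul]]

/-- **The `σ`-block `b|_{ι×ι} ∈ GL_σ` of an upper triangular `b ∈ GL_τ`** (its inverse is the
block of `b⁻¹`). [folklore] -/
def upperBlock (hι : StrictMono ι) (hup : IsUpperSet (Set.range ι)) (b : GL τ k)
    (hb : IsUpperTriangular b) : GL σ k where
  val := (b : Matrix τ τ k).submatrix ι ι
  inv := ((b⁻¹ : GL τ k) : Matrix τ τ k).submatrix ι ι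
  val_inv := by
    rw [submatrix_mul_of_upper hι hup (fun x y h => hb.apply_eq_zero h), ← Units.val_mul,
      mul_inv_cancel, Units.val_one, Matrix.submatrix_one _ hι.injective]
  inv_val := by
    rw [submatrix_mul_of_upper hι hup (fun x y h => ((borelSubgroup τ k).inv_mem hb).apply_eq_zero h),
      ← Units.val_mul, inv_mul_cancel, Units.val_one, Matrix.submatrix_one _ hι.injective]

/-- Entries of the block. [folklore] -/
@[simp]
theorem upperBlock_apply (hι : StrictMono ι) (hup : IsUpperSet (Set.range ι)) (b : GL τ k)
    (hb : IsUpperTriangular b) (i j : σ) :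
    (upperBlock hι hup b hb : Matrix σ σ k) i j = (b : Matrix τ τ k) (ι i) (ι j) :=
  rfl

/-- Entries of the inverse of the block. [folklore] -/
@[simp]
theorem upperBlock_inv_apply (hι : StrictMono ι) (hup : IsUpperSet (Set.range ι)) (b : GL τ k)
    (hb : IsUpperTriangular b) (i j : σ) :
    (((upperBlock hι hup b hb)⁻¹ : GL σ k) : Matrix σ σ k) i j =
      ((b⁻¹ : GL τ k) : Matrix τ τ k) (ι i) (ι j) :=
  rfl

/-- The block of an upper triangular matrix is upper triangular. [folklore] -/
theorem isUpperTriangular_upperBlock (hι : StrictMono ι) (hup : IsUpperSet (Set.range ι))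
    (b : GL τ k) (hb : IsUpperTriangular b) : IsUpperTriangular (upperBlock hι hup b hb) :=
  fun _ _ hij => hb.apply_eq_zero (hι hij)

/-- The weight character of `χ` at the block is the weight character at `b` of `χ` extended by
zero along `ι`. [folklore] -/
theorem weightChar_upperBlock (hι : StrictMono ι) (hup : IsUpperSet (Set.range ι))
    (χ : Weight σ) (b : GL τ k) (hb : IsUpperTriangular b) :
    weightChar χ (upperBlock hι hup b hb) = weightChar (Function.extend ι χ 0) b := by
  rw [weightChar, weightChar, prod_eq_prod_app hι.injective _ fun x hx => by
    rw [Function.extend_apply' _ _ _ (fun ⟨j, hj⟩ => hx ⟨j, hj⟩), Pi.zero_apply, zpow_zero]]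
  refine Finset.prod_congr rfl fun j _ => ?_
  rw [hι.injective.extend_apply, upperBlock_apply]

variable {m : ℕ}

/-- Renaming degree-`m` monomials of `k[x_σ]` to monomials of `k[x_τ]` along `ι`. [folklore] -/
def degIdxMap (hι : Function.Injective ι) (d : DegIdx σ m) : DegIdx τ m :=
  ⟨d.1.mapDomain ι, by
    have := hι
    rw [mem_degMonomials_iff, Finsupp.degree_mapDomain]
    exact mem_degMonomials_iff.mp d.2⟩

/-- Unfolding of `degIdxMap`. [folklore] -/
theorem degIdxMap_val (hι : Function.Injective ι) (d : DegIdx σ m) :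
    (degIdxMap hι d).1 = d.1.mapDomain ι :=
  rfl

/-- `degIdxMap` is injective. [folklore] -/
theorem degIdxMap_injective (hι : Function.Injective ι) :
    Function.Injective (degIdxMap (m := m) hι) :=
  fun _ _ h => Subtype.ext (Finsupp.mapDomain_injective hι (congrArg Subtype.val h))

/-- A degree-`m` monomial in the `ι`-variables is the renaming of a monomial of `k[x_σ]`.
[folklore] -/
theorem exists_eq_degIdxMap (hι : Function.Injective ι) {E : DegIdx τ m}
    (hE : ↑E.1.support ⊆ Set.range ι) : ∃ e, degIdxMap hι e = E := by
  refine ⟨⟨E.1.comapDomain ι hι.injOn, ?_⟩, ?_⟩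
  · rw [mem_degMonomials_iff, ← Finsupp.degree_mapDomain ι, E.1.mapDomain_comapDomain ι hι hE]
    exact mem_degMonomials_iff.mp E.2
  · exact Subtype.ext (E.1.mapDomain_comapDomain ι hι hE)

/-- A sum over all degree-`m` monomials of `k[x_τ]` of a function vanishing off the monomials in
the `ι`-variables is the sum over the latter. [folklore] -/
theorem sum_eq_sum_degIdxMap (hι : Function.Injective ι) {M : Type*} [AddCommMonoid M]
    (f : DegIdx τ m → M) (hf : ∀ E, ¬ (↑E.1.support ⊆ Set.range ι) → f E = 0) :
    ∑ E, f E = ∑ e : DegIdx σ m, f (degIdxMap hι e) := by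
  have h1 : ∑ E ∈ Finset.univ.map ⟨degIdxMap hι, degIdxMap_injective hι⟩, f E =
      ∑ e : DegIdx σ m, f (degIdxMap hι e) := Finset.sum_map _ _ _
  rw [← h1]
  refine (Finset.sum_subset (Finset.subset_univ _) fun E _ hE => hf E fun hsub => hE ?_).symm
  obtain ⟨e, rfl⟩ := exists_eq_degIdxMap hι hsub
  exact Finset.mem_map.mpr ⟨e, Finset.mem_univ e, rfl⟩

/-- **The action of an upper triangular `b ∈ GL_τ` on a renamed coordinate function is the renamed
action of its block**: `b · X_{ι d} = ι (b|_{ι×ι} · X_d)` on `k[Sym^m]` (`coordSubst` substitutes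
`X_d ↦ ∑_e coeff_d(b⁻¹ · x^e) X_e`; for `d` in the `ι`-variables only monomials `e` in the
`ι`-variables contribute, with the coefficients of the block, by `killCompl_linSubst`). [folklore] -/
theorem coordSubst_rename_degIdxMap (hι : StrictMono ι) (hup : IsUpperSet (Set.range ι))
    (b : GL τ k) (hb : IsUpperTriangular b) (F : MvPolynomial (DegIdx σ m) k) :
    coordSubst m b (rename (degIdxMap hι.injective) F) =
      rename (degIdxMap hι.injective) (coordSubst m (upperBlock hι hup b hb) F) := by
  suffices h : (coordSubst m b).comp (rename (degIdxMap hι.injective)) =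
      (rename (degIdxMap hι.injective)).comp (coordSubst (k := k) m (upperBlock hι hup b hb)) from
    congrArg (fun φ => φ F) h
  apply MvPolynomial.algHom_ext
  intro d
  rw [AlgHom.comp_apply, AlgHom.comp_apply, rename_X, coordSubst_X, coordSubst_X, map_sum]
  simp only [map_smul, rename_X]
  have hb' : IsUpperTriangular b⁻¹ := (borelSubgroup τ k).inv_mem hb
  -- the coefficient of `x^{ι d}` in `b⁻¹ · x^E`
  have key : ∀ E : DegIdx τ m,
      coeff (degIdxMap hι.injective d).1 (linSubstRep τ k b⁻¹ (monomial E.1 1)) =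
        coeff d.1 (linSubst σ k ((upperBlock hι hup b hb)⁻¹ : GL σ k)
          (killCompl hι.injective (monomial E.1 (1 : k)))) := by
    intro E
    rw [linSubstRep_apply, degIdxMap_val, ← coeff_killCompl hι.injective,
      killCompl_linSubst hι hup _ fun x y h => hb'.apply_eq_zero h]
    rfl
  simp only [key]
  rw [sum_eq_sum_degIdxMap hι.injective _ fun E hE => by
    rw [killCompl_monomial_eq_zero_of_not_subset _ _ hE, map_zero, coeff_zero, zero_smul]]
  refine Finset.sum_congr rfl fun e _ => ?_
  rw [degIdxMap_val, killCompl_monomial_mapDomain, linSubstRep_apply]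

/-- **Inheritance of highest-weight vectors.** If `F ∈ k[Sym^m k^σ]` is a highest-weight vector of
weight `χ` for the upper triangular Borel of `GL_σ`, then `F` renamed along `ι` is a highest-weight
vector of `k[Sym^m k^τ]` for the upper triangular Borel of `GL_τ`, of weight `χ` extended by zero.
[cite: BurgisserHuttenhainIkenmeyer2017, §3 (inheritance, proof of Lemma 6)] -/
theorem rename_mem_highestWeightSpace_coordRep (hι : StrictMono ι) (hup : IsUpperSet (Set.range ι))
    {χ : Weight σ} {F : MvPolynomial (DegIdx σ m) k}
    (hF : F ∈ highestWeightSpace (coordRep σ k m) χ) :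
    rename (degIdxMap hι.injective) F ∈
      highestWeightSpace (coordRep τ k m) (Function.extend ι χ 0) := by
  intro b hb
  rw [coordRep_apply, coordSubst_rename_degIdxMap hι hup b hb, ← coordRep_apply,
    hF _ (isUpperTriangular_upperBlock hι hup b hb), map_smul, weightChar_upperBlock]

/-- **Restriction of regular functions** (BHI §1 (2): for `Z' ⊆ Z` closed and `G`-invariant,
`𝒪(Z) ↠ 𝒪(Z')`), in the form needed: let `f ∈ k[x_σ]`, and `f' ∈ k[x_τ]` a nonzero form of degree
`m` whose orbit closure contains the renamed orbit of `f` (`ι(g · f) ∈ \overline{GL_τ · f'}` for all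
`g`). Then a polynomial `F` on `Sym^m k^σ` not vanishing on the orbit `GL_σ · f` renames to a
polynomial on `Sym^m k^τ` not vanishing on the orbit of `f'`: it does not vanish at some point
`ι(g · f)` of the orbit closure, on which the vanishing ideal of the orbit vanishes
(`mem_orbitClosure_iff_formCoeff_holds`). [cite: BurgisserHuttenhainIkenmeyer2017, §1 (2)] -/
theorem rename_not_mem_orbitVanishingIdeal (hι : Function.Injective ι) {f : MvPolynomial σ k}
    {f' : MvPolynomial τ k} (hf' : f'.IsHomogeneous m) (hf'0 : f' ≠ 0)
    (hpts : ∀ g : GL σ k, rename ι (linSubstRep σ k g f) ∈ orbitClosure f')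
    {F : MvPolynomial (DegIdx σ m) k} (hF : F ∉ orbitVanishingIdeal f m) :
    rename (degIdxMap hι) F ∉ orbitVanishingIdeal f' m := by
  obtain ⟨g, hg⟩ := exists_aeval_formCoeff_ne_zero_of_not_mem hF
  intro hmem
  apply hg
  have hzero := ((mem_orbitClosure_iff_formCoeff_holds hf' hf'0).mp (hpts g)).2
  rw [MvPolynomial.mem_zeroLocus_iff] at hzero
  have h0 := hzero _ hmem
  rw [aeval_rename] at h0
  have hfun : formCoeff m (rename ι (linSubstRep σ k g f)) ∘ degIdxMap hι =
      formCoeff m (linSubstRep σ k g f) := by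
    funext d
    rw [Function.comp_apply, formCoeff_apply, formCoeff_apply, degIdxMap_val,
      coeff_rename_mapDomain _ hι]
  rw [hfun] at h0
  exact h0

/-- **An honest highest-weight vector outside the ideal** (complete reducibility, characteristic
zero): if `χ` occurs in `k[Δ_m[f]] = k[Sym^m] ⧸ I(GL · f)`, some highest-weight vector
`F ∈ k[Sym^m]` of weight `χ` lies outside `I(GL · f)` — the highest-weight space of the quotient
is the image of that of `k[Sym^m]` (`map_highestWeightSpace_eq_of_surjective`,
`isSemisimpleRepresentation_coordRep`). BHI §1: "Schur's lemma implies that `S(Z') ⊆ S(Z)`".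
[cite: BurgisserHuttenhainIkenmeyer2017, §1 (2)] -/
theorem exists_mem_highestWeightSpace_not_mem [CharZero k] (f : MvPolynomial σ k) (m : ℕ)
    {χ : Weight σ} (h : HasHighestWeight (orbitCoordRep f m) χ) :
    ∃ F ∈ highestWeightSpace (coordRep σ k m) χ, F ∉ orbitVanishingIdeal f m := by
  obtain ⟨x, hx0, hx⟩ := (hasHighestWeight_iff_exists _ _).mp h
  have hsurj : Function.Surjective (mkIntertwiningMap f m) := by
    intro y
    obtain ⟨F, rfl⟩ := Ideal.Quotient.mk_surjective y
    exact ⟨F, rfl⟩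
  have hmap := map_highestWeightSpace_eq_of_surjective (mkIntertwiningMap f m) hsurj
    (isSemisimpleRepresentation_coordRep m) χ
  rw [← hmap] at hx
  obtain ⟨F, hF, hFx⟩ := Submodule.mem_map.mp hx
  refine ⟨F, hF, fun hI => hx0 ?_⟩
  rw [← hFx]
  change mkIntertwiningMap f m F = 0
  rw [mkIntertwiningMap_apply, Ideal.Quotient.eq_zero_iff_mem]
  exact hI

/-- **Occurrence is inherited along `ι` from `k[\overline{GL_σ · f}]` to `k[\overline{GL_τ · f'}]`**
(characteristic zero) whenever the orbit closure of the nonzero degree-`m` form `f'` contains the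
renamed orbit of `f`: the weight `χ` of `GL_σ` occurring in the former occurs, extended by zero, in
the latter (`exists_mem_highestWeightSpace_not_mem`, `rename_mem_highestWeightSpace_coordRep`,
`rename_not_mem_orbitVanishingIdeal`, `hasHighestWeight_orbitCoordRep_of_not_mem`). This is BHI's
"`S(Z') ⊆ S(Z)`" combined with inheritance. [cite: BurgisserHuttenhainIkenmeyer2017, §1 (2) and §3] -/
theorem hasHighestWeight_orbitCoordRep_extend [CharZero k] (hι : StrictMono ι)
    (hup : IsUpperSet (Set.range ι)) {f : MvPolynomial σ k} {f' : MvPolynomial τ k}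
    (hf' : f'.IsHomogeneous m) (hf'0 : f' ≠ 0)
    (hpts : ∀ g : GL σ k, rename ι (linSubstRep σ k g f) ∈ orbitClosure f') {χ : Weight σ}
    (h : HasHighestWeight (orbitCoordRep f m) χ) :
    HasHighestWeight (orbitCoordRep f' m) (Function.extend ι χ 0) := by
  obtain ⟨F, hF, hFI⟩ := exists_mem_highestWeightSpace_not_mem f m h
  exact hasHighestWeight_orbitCoordRep_of_not_mem f' m
    (rename_mem_highestWeightSpace_coordRep hι hup hF)
    (rename_not_mem_orbitVanishingIdeal hι.injective hf' hf'0 hpts hFI)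

end UpperEmbedding

/-! ### The last row of the matrix: the greatest `m` letters of `MatIdx m` -/

section LastRow

variable {m : ℕ}

/-- The embedding `j ↦ (m-1, j)` of `Fin m` onto the last row of the lexicographically ordered
matrix positions `MatIdx m = Fin m ×ₗ Fin m` — the greatest `m` indices (BHI identify `X_i` with
`X_{ii}`; with the tree's dual-weight convention the `m` letters carrying a weight of length `≤ m`
are the greatest ones, so we identify `X_i` with `X_{m-1,i}` instead, which changes nothing up to
the `GL_{m²}`-action). [cite: BurgisserHuttenhainIkenmeyer2017, §3 (identification of X_i with X_ii)] -/
def lastRow (j : Fin m) : MatIdx m :=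
  toLex ((⟨m - 1, by have := j.2; omega⟩ : Fin m), j)

/-- `lastRow` is strictly monotone. [folklore] -/
theorem lastRow_strictMono : StrictMono (lastRow (m := m)) := by
  intro i j hij
  rw [lastRow, lastRow, Prod.Lex.toLex_lt_toLex]
  exact Or.inr ⟨rfl, hij⟩

/-- `lastRow` is injective. [folklore] -/
theorem lastRow_injective : Function.Injective (lastRow (m := m)) :=
  lastRow_strictMono.injective

/-- A matrix position lies in the last row iff its row index is `m - 1`. [folklore] -/
theorem mem_range_lastRow_iff (x : MatIdx m) :
    x ∈ Set.range (lastRow (m := m)) ↔ (((ofLex x).1 : Fin m) : ℕ) = m - 1 := by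
  constructor
  · rintro ⟨j, rfl⟩
    rfl
  · intro h
    refine ⟨(ofLex x).2, ?_⟩
    rw [lastRow]
    conv_rhs => rw [← toLex_ofLex x]
    congr 1
    exact Prod.ext (Fin.ext (by simpa using h.symm)) rfl

/-- The last row is an upper set of `MatIdx m`. [folklore] -/
theorem isUpperSet_range_lastRow : IsUpperSet (Set.range (lastRow (m := m))) := by
  rintro a x h ⟨j, rfl⟩
  rw [mem_range_lastRow_iff]
  have hx : ((ofLex x).1 : ℕ) < m := (ofLex x).1.2
  rw [lastRow, ← toLex_ofLex x, Prod.Lex.toLex_le_toLex] at h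
  rcases h with h | ⟨h, -⟩
  · have h' : m - 1 < ((ofLex x).1 : ℕ) := h
    omega
  · have h' := congrArg Fin.val h
    simpa using h'.symm

/-- Enumeration: `(matIdxEquiv m)⁻¹ (lastRow j) = j + m(m-1)`. [folklore] -/
theorem matIdxEquiv_symm_lastRow_val (j : Fin m) :
    (((matIdxEquiv m).symm (lastRow j) : Fin (m * m)) : ℕ) = j + m * (m - 1) := by
  have h : (matIdxEquiv m).symm (lastRow j) =
      finProdFinEquiv ((⟨m - 1, by have := j.2; omega⟩ : Fin m), j) := by
    apply (matIdxEquiv m).injective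
    rw [OrderIso.apply_symm_apply, matIdxEquiv_apply, Equiv.symm_apply_apply]
    rfl
  rw [h, finProdFinEquiv_apply_val]

/-- **The weight bookkeeping**: the dual of the padded weight `(χ, 0, …, 0)`, transported to the
matrix positions, is the dual of `χ` extended by zero to the last row. [folklore] -/
theorem toMatIdx_dual_padWeight (χ : Weight (Fin m)) :
    (Weight.dual (padWeight m χ)).toMatIdx = Function.extend lastRow χ.dual 0 := by
  funext x
  rw [Weight.toMatIdx]
  by_cases hx : x ∈ Set.range (lastRow (m := m))
  · obtain ⟨j, rfl⟩ := hx
    rw [lastRow_injective.extend_apply, Weight.dual, Weight.dual, padWeight_apply]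
    have hj := j.2
    have hval : ((Fin.rev ((matIdxEquiv m).symm (lastRow j)) : Fin (m * m)) : ℕ) = m - 1 - j := by
      rw [Fin.val_rev, matIdxEquiv_symm_lastRow_val]
      have : j + m * (m - 1) + 1 ≤ m * m := by
        have h1 : m * (m - 1) + m = m * m := by
          rw [← Nat.mul_succ, Nat.succ_eq_add_one, Nat.sub_add_cancel (by omega)]
        omega
      zify [this, (by omega : (j : ℕ) ≤ m - 1), (by omega : 1 ≤ m)] at *
      nlinarith [this]
    have hlt : ((Fin.rev ((matIdxEquiv m).symm (lastRow j)) : Fin (m * m)) : ℕ) < m := by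
      rw [hval]; omega
    rw [dif_pos hlt]
    congr 2
    exact Fin.ext (by rw [hval, Fin.val_rev]; omega)
  · rw [Function.extend_apply' _ _ _ (fun ⟨j, hj⟩ => hx ⟨j, hj⟩), Pi.zero_apply, Weight.dual,
      padWeight_apply, dif_neg, neg_zero]
    intro hlt
    apply hx
    -- the position `x` has enumeration index `≥ m(m-1)`, so it lies in the last row
    rw [mem_range_lastRow_iff]
    set n : Fin (m * m) := (matIdxEquiv m).symm x with hn
    have hxn : x = matIdxEquiv m n := by rw [hn, OrderIso.apply_symm_apply]
    have hnval : (n : ℕ) = ((ofLex x).2 : ℕ) + m * ((ofLex x).1 : ℕ) := by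
      have : n = finProdFinEquiv (ofLex x) := by
        apply (matIdxEquiv m).injective
        rw [← hxn, matIdxEquiv_apply, Equiv.symm_apply_apply, toLex_ofLex]
      rw [this, finProdFinEquiv_apply_val]
    have h1 : ((ofLex x).1 : ℕ) < m := (ofLex x).1.2
    have h2 : ((ofLex x).2 : ℕ) < m := (ofLex x).2.2
    rw [Fin.val_rev] at hlt
    by_contra hne
    have h3 : ((ofLex x).1 : ℕ) + 1 ≤ m - 1 := by omega
    have h4 : (n : ℕ) + 1 ≤ m * (m - 1) := by
      calc (n : ℕ) + 1 = ((ofLex x).2 : ℕ) + 1 + m * ((ofLex x).1 : ℕ) := by rw [hnval]; ring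
        _ ≤ m + m * ((ofLex x).1 : ℕ) := by omega
        _ = m * (((ofLex x).1 : ℕ) + 1) := by ring
        _ ≤ m * (m - 1) := Nat.mul_le_mul_left m h3
    have h5 : m * (m - 1) + m = m * m := by
      rw [← Nat.mul_succ, Nat.succ_eq_add_one, Nat.sub_add_cancel (by omega)]
    omega

end LastRow

/-! ### `Chow_m ⊆ Det_m`: products of linear forms in the last-row variables are degenerations
of `det_m` -/

section ChowPoint

variable {k : Type*} [Field k] {m : ℕ}

/-- The substitution matrix sending the diagonal variable `x_{ii}` to the last-row linear form
`∑_l g_{l i} x_{m-1,l}` and every off-diagonal variable to `0` (BHI: "The linear substitution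
`X_{ii} ↦ X_{ii}`, `X_{ij} ↦ εX_{ij}` ... We obtain `X_{11}⋯X_{nn}` in the limit"; here directly the
noninvertible substitution at `ε = 0`, composed with `g` on the diagonal variables).
[cite: BurgisserHuttenhainIkenmeyer2017, §3 (Chow_n ⊆ Det_n)] -/
def diagToLastRow (g : Matrix (Fin m) (Fin m) k) : Matrix (MatIdx m) (MatIdx m) k :=
  Matrix.of fun y x => if (ofLex x).1 = (ofLex x).2 ∧ y ∈ Set.range (lastRow (m := m)) then
    g (ofLex y).2 (ofLex x).1 else 0

/-- The substitution `diagToLastRow g` on a variable: `x_{ij} ↦ 0` for `i ≠ j` and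
`x_{ii} ↦ ι (g · x_i)`. [folklore] -/
theorem linSubst_diagToLastRow_X (g : Matrix (Fin m) (Fin m) k) (i j : Fin m) :
    linSubst _ k (diagToLastRow g) (X (toLex (i, j))) =
      if i = j then rename lastRow (linSubst _ k g (X i)) else 0 := by
  classical
  rw [linSubst_X]
  split_ifs with hij
  · rw [linSubst_X, map_sum, sum_eq_sum_app lastRow_injective _ fun y hy => by
      rw [diagToLastRow, Matrix.of_apply, if_neg (fun h => hy h.2), zero_smul]]
    refine Finset.sum_congr rfl fun l _ => ?_
    rw [map_smul, rename_X, diagToLastRow, Matrix.of_apply, if_pos ⟨hij, l, rfl⟩]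
    rfl
  · refine Finset.sum_eq_zero fun y _ => ?_
    rw [diagToLastRow, Matrix.of_apply, if_neg (fun h => hij h.1), zero_smul]

/-- **`Chow_m ⊆ Det_m`** in the form needed: for every `g ∈ Mat_m(k)`, the product of linear forms
`ι(g · (x_0⋯x_{m-1})) = ∏_i ι(g · x_i)` in the last-row variables is the degeneration
`diagToLastRow g · det_m` of the determinant (the determinant of a diagonal matrix of linear
forms). BHI: "`Chow_n` is contained in the `Gl_{n²}`-orbit closure `Det_n`".
[cite: BurgisserHuttenhainIkenmeyer2017, §3 (Chow_n ⊆ Det_n)] -/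
theorem linSubst_diagToLastRow_detFormLex (g : Matrix (Fin m) (Fin m) k) :
    linSubst _ k (diagToLastRow g) (detFormLex k m) =
      rename lastRow (linSubst _ k g (chowMonomial k m)) := by
  classical
  rw [detFormLex, detPoly, AlgHom.map_det, AlgHom.map_det, AlgHom.mapMatrix_apply,
    AlgHom.mapMatrix_apply]
  have hM : ((Matrix.mvPolynomialX (Fin m) (Fin m) k).map (rename toLex)).map
      (linSubst (MatIdx m) k (diagToLastRow g)) =
      Matrix.diagonal fun i => rename lastRow (linSubst _ k g (X i)) := by
    ext i j
    rw [Matrix.map_apply, Matrix.map_apply, Matrix.mvPolynomialX_apply, rename_X,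
      linSubst_diagToLastRow_X, Matrix.diagonal_apply]
  rw [hM, Matrix.det_diagonal, chowMonomial, map_prod, map_prod]

/-- Hence `ι(g · w_m) ∈ Ω_m` for every matrix `g`, over an infinite field
(`endOrbit_subset_orbitClosure_holds`: BHI's limit `ε → 0` replaced by `End · det_m ⊆ Ω_m`).
[cite: BurgisserHuttenhainIkenmeyer2017, §3 (Chow_n ⊆ Det_n)] -/
theorem rename_linSubst_chowMonomial_mem_orbitClosure [Infinite k] (g : Matrix (Fin m) (Fin m) k) :
    rename lastRow (linSubst _ k g (chowMonomial k m)) ∈ orbitClosure (detFormLex k m) := by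
  rw [← linSubst_diagToLastRow_detFormLex]
  exact endOrbit_subset_orbitClosure_holds _ ⟨diagToLastRow g, rfl⟩

end ChowPoint

/-! ### The discharge -/

section Discharge

variable {k : Type*} [Field k] {m : ℕ}

/-- **`S(Chow_m) ⊆ S(Det_m)` in weight form**: in characteristic zero, a weight `χ` of `GL_m`
occurring in `k[Chow_m] = k[\overline{GL_m · x_0⋯x_{m-1}}]` occurs, extended by zero to the last
row, in `k[Ω_m] = k[\overline{GL_{m²} · det_m}]` (`hasHighestWeight_orbitCoordRep_extend` along
`lastRow`, the points `ι(g · w_m)` lying in `Ω_m`). [cite: BurgisserHuttenhainIkenmeyer2017, §3 (S(Chow_n) ⊆ S(Det_n))] -/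
theorem hasHighestWeight_detOrbitRep_extend_of_chow [CharZero k] {χ : Weight (Fin m)}
    (h : HasHighestWeight (orbitCoordRep (chowMonomial k m) m) χ) :
    HasHighestWeight (detOrbitRep k m) (Function.extend lastRow χ 0) := by
  haveI : Infinite k := Infinite.of_injective _ Nat.cast_injective
  exact hasHighestWeight_orbitCoordRep_extend lastRow_strictMono isUpperSet_range_lastRow
    (detFormLex_isHomogeneous k m) (detFormLex_ne_zero m)
    (fun g => by
      rw [linSubstRep_apply]
      exact rename_linSubst_chowMonomial_mem_orbitClosure (g : Matrix (Fin m) (Fin m) k)) h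

/-- **Discharge of `BHI2017_chow_le_det`** (`S(Chow_n) ⊆ S(Det_n)`, BHI §3): for
`χ ∈ S(Chow_m)`, the dual weight `χ^*` occurs in `ℂ[Chow_m]`, hence
(`hasHighestWeight_detOrbitRep_extend_of_chow`) its extension by zero to the last row — which is
the transported dual of the padded weight (`toMatIdx_dual_padWeight`) — occurs in `ℂ[Ω_m]`, i.e.
`padWeight m χ ∈ S(Det_m)`. [cite: BurgisserHuttenhainIkenmeyer2017, §3 (S(Chow_n) ⊆ S(Det_n))] -/
theorem BHI2017_chow_le_det_holds : BHI2017_chow_le_det := by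
  intro m χ hχ
  rw [mem_detOccWeights_iff, toMatIdx_dual_padWeight]
  exact hasHighestWeight_detOrbitRep_extend_of_chow ((mem_chowOccWeights_iff m χ).mp hχ)

/-- **BHI Theorem 1 from Theorem 3 alone**: with `S(Chow_n) ⊆ S(Det_n)` discharged, the named fact
`BHI2017_thm1` (hence the barrier `NotViaSaturations`) rests on BHI's Theorem 3 about the Chow
variety only. [cite: BurgisserHuttenhainIkenmeyer2017, §3 (Thm. 1 from Thm. 3)] -/
theorem BHI2017_thm1_of_thm3 (h₃ : BHI2017_thm3) : BHI2017_thm1 :=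
  BHI2017_thm1_of_chow BHI2017_chow_le_det_holds h₃

/-- The same from Propositions 2 and 3. [cite: BurgisserHuttenhainIkenmeyer2017, §3] -/
theorem BHI2017_thm1_of_prop2_of_prop3 (h₂ : BHI2017_prop2) (h₃ : BHI2017_prop3) : BHI2017_thm1 :=
  BHI2017_thm1_of_props BHI2017_chow_le_det_holds h₂ h₃

/-- Consequently the barrier fact `NotViaSaturations` follows from BHI's Theorem 3.
[cite: BurgisserHuttenhainIkenmeyer2017, Thm. 1 and Thm. 3] -/
theorem notViaSaturations_of_thm3 (h₃ : BHI2017_thm3) : NotViaSaturations :=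
  BHI2017_thm1_of_thm3 h₃

end Discharge

/-! ### First steps of the proof of Prop. 3: the generation lemma for `L` and `λ^{(1)} = (m)` -/

section PropThree

variable {m : ℕ}

/-- **The last step of BHI's proof of Prop. 3, as a lemma on subgroups of `ℤ^m`**: "Clearly,
`λ^{(1)} := (n,0,…,0) ∈ A`. For `3 ≤ k ≤ n` let `λ^{(k)} ∈ A` denote the partition from Lemma 6.
Then we have `λ^{(k)}_k = 1` and `λ^{(k)}_i = 0` for `i > k` for all `2 ≤ k ≤ n`. This easily
implies that `λ^{(1)},…,λ^{(n)}` generate the group `L`." Precisely (0-based indices): a subgroup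
`A` of `ℤ^m` containing `(m,0,…,0)` and, for every index `1 ≤ k < m`, an element `w ∈ L` with
`w_k = 1` and `w_i = 0` for `i > k`, contains `L` (induction on the support: subtract
`χ_k w` to shorten the support of `χ ∈ L`; a `χ ∈ L` supported at `0` is a multiple of
`(m,0,…,0)`). [cite: BurgisserHuttenhainIkenmeyer2017, Prop. 3 (proof, generation of L)] -/
theorem bhiLattice_le_of_generators (A : AddSubgroup (Weight (Fin m)))
    (h1 : ∀ hm : 0 < m, (Pi.single (⟨0, hm⟩ : Fin m) (m : ℤ) : Weight (Fin m)) ∈ A)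
    (hk : ∀ k : Fin m, 0 < (k : ℕ) → ∃ w ∈ A, w ∈ bhiLattice m ∧ w k = 1 ∧
      ∀ i : Fin m, k < i → w i = 0) :
    bhiLattice m ≤ A := by
  suffices H : ∀ (j : ℕ) (χ : Weight (Fin m)), χ ∈ bhiLattice m →
      (∀ i : Fin m, j < (i : ℕ) → χ i = 0) → χ ∈ A from
    fun χ hχ => H m χ hχ fun i hi => absurd i.2 (not_lt.mpr hi.le)
  intro j
  induction j with
  | zero =>
    intro χ hχ hsupp
    rcases Nat.eq_zero_or_pos m with hm | hm
    · subst hm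
      have : χ = 0 := funext fun i => i.elim0
      rw [this]
      exact zero_mem A
    · rw [mem_bhiLattice_iff, Weight.size] at hχ
      have h0 : ∀ i : Fin m, i ≠ ⟨0, hm⟩ → χ i = 0 := fun i hi =>
        hsupp i (Nat.pos_of_ne_zero fun h0 => hi (Fin.ext h0))
      have hsum : ∑ i, χ i = χ ⟨0, hm⟩ := by
        rw [Finset.sum_eq_single ⟨0, hm⟩ (fun i _ hi => h0 i hi)
          (fun h => absurd (Finset.mem_univ _) h)]
      rw [hsum] at hχ
      obtain ⟨q, hq⟩ := hχ
      have hχeq : χ = q • (Pi.single (⟨0, hm⟩ : Fin m) (m : ℤ) : Weight (Fin m)) := by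
        funext i
        by_cases hi : i = ⟨0, hm⟩
        · subst hi
          rw [Pi.smul_apply, Pi.single_eq_same, smul_eq_mul, hq, mul_comm]
        · rw [Pi.smul_apply, Pi.single_eq_of_ne hi, smul_zero]
          exact h0 i hi
      rw [hχeq]
      exact A.zsmul_mem (h1 hm) q
  | succ j ih =>
    intro χ hχ hsupp
    by_cases hjm : j + 1 < m
    · obtain ⟨w, hwA, hwL, hwk, hwi⟩ := hk ⟨j + 1, hjm⟩ (Nat.succ_pos j)
      have hχ' : χ - χ ⟨j + 1, hjm⟩ • w ∈ A := by
        refine ih _ ((bhiLattice m).sub_mem hχ ((bhiLattice m).zsmul_mem hwL _)) fun i hi => ?_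
        rw [Pi.sub_apply, Pi.smul_apply, smul_eq_mul]
        rcases (Nat.succ_le_of_lt hi).lt_or_eq with hlt | heq
        · rw [hsupp i hlt, hwi i (Fin.lt_def.mpr hlt), mul_zero, sub_zero]
        · have : i = ⟨j + 1, hjm⟩ := Fin.ext heq.symm
          subst this
          rw [hwk, mul_one, sub_self]
      have := A.add_mem hχ' (A.zsmul_mem hwA (χ ⟨j + 1, hjm⟩))
      rwa [sub_add_cancel] at this
    · exact ih χ hχ fun i hi => absurd i.2 (by omega)

/-- Hence: if `A(S(Chow_m))` contains, for every `1 ≤ k < m` (0-based), an element with `k`-th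
coordinate `1` and vanishing coordinates beyond `k`, then `A(S(Chow_m)) = L`, PROVIDED
`λ^{(1)} = (m,0,…,0) ∈ S(Chow_m)` — which is `single_zero_mem_chowOccWeights` below. This reduces
`BHI2017_prop3` to the existence of BHI's `λ^{(2)},…,λ^{(m)}` in `A(S(Chow_m))` (Lemma 6 and the
two plethysm checks). [cite: BurgisserHuttenhainIkenmeyer2017, Prop. 3 (proof)] -/
theorem closure_chowOccWeights_eq_bhiLattice_of_generators
    (h1 : ∀ hm : 0 < m, (Pi.single (⟨0, hm⟩ : Fin m) (m : ℤ) : Weight (Fin m)) ∈ chowOccWeights m)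
    (hk : ∀ k : Fin m, 0 < (k : ℕ) →
      ∃ w ∈ AddSubgroup.closure (chowOccWeights m : Set (Weight (Fin m))),
        w k = 1 ∧ ∀ i : Fin m, k < i → w i = 0) :
    AddSubgroup.closure (chowOccWeights m : Set (Weight (Fin m))) = bhiLattice m := by
  refine le_antisymm (closure_chowOccWeights_le_bhiLattice m)
    (bhiLattice_le_of_generators _ (fun hm => AddSubgroup.subset_closure (h1 hm)) fun k hk0 => ?_)
  obtain ⟨w, hw, hwk, hwi⟩ := hk k hk0
  exact ⟨w, hw, closure_chowOccWeights_le_bhiLattice m hw, hwk, hwi⟩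

/-- **`λ^{(1)} = (m,0,…,0) ∈ S(Chow_m)`** ("Clearly, `λ^{(1)} := (n,0,…,0) ∈ A`"; indeed
`(n) ∈ S(Chow_n)` in degree `1`): the dual weight `-m ε_{m-1}` has the highest-weight vector
"coefficient of `x_{m-1}^m`" in `k[Sym^m k^m]` (`X_mem_highestWeightSpace_coordRep`), which takes
the value `1` at the point `x_{m-1} ∏_{i<m-1}(x_i + x_{m-1})` of the orbit `GL_m · w_m`.
[cite: BurgisserHuttenhainIkenmeyer2017, Prop. 3 (proof, λ^(1))] -/
theorem single_zero_mem_chowOccWeights (hm : 0 < m) :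
    (Pi.single (⟨0, hm⟩ : Fin m) (m : ℤ) : Weight (Fin m)) ∈ chowOccWeights m := by
  classical
  rw [mem_chowOccWeights_iff]
  set iₘ : Fin m := Fin.rev ⟨0, hm⟩ with hiₘ
  have htop : ∀ i : Fin m, i ≤ iₘ := fun i => by
    rw [hiₘ, Fin.le_rev_iff]
    exact Fin.mk_le_of_le_val (Nat.zero_le _)
  have hdual : Weight.dual (Pi.single (⟨0, hm⟩ : Fin m) (m : ℤ)) = Pi.single iₘ (-(m : ℤ)) := by
    funext i
    simp only [Weight.dual]
    by_cases hi : i = iₘ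
    · rw [hi, Pi.single_eq_same, hiₘ, Fin.rev_rev, Pi.single_eq_same]
    · rw [Pi.single_eq_of_ne hi, Pi.single_eq_of_ne, neg_zero]
      intro h
      apply hi
      rw [hiₘ, ← h, Fin.rev_rev]
  rw [hdual]
  set d : DegIdx (Fin m) m := ⟨Finsupp.single iₘ m, by
    rw [mem_degMonomials_iff, Finsupp.degree_single]⟩ with hd
  refine hasHighestWeight_orbitCoordRep_of_not_mem _ m
    (X_mem_highestWeightSpace_coordRep (k := ℂ) m iₘ htop d rfl) ?_
  -- the unipotent `x_i ↦ x_i + x_{iₘ}` (`i ≠ iₘ`)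
  set E : Matrix (Fin m) (Fin m) ℂ := Matrix.of fun y x => if y = iₘ ∧ x ≠ iₘ then 1 else 0
    with hE
  have hE2 : E * E = 0 := by
    ext y x
    rw [Matrix.mul_apply, Matrix.zero_apply]
    refine Finset.sum_eq_zero fun l _ => ?_
    by_cases hl : l = iₘ
    · have : E y l = 0 := by
        rw [hE, Matrix.of_apply, if_neg]
        exact fun h => h.2 hl
      rw [this, zero_mul]
    · have : E l x = 0 := by
        rw [hE, Matrix.of_apply, if_neg]
        exact fun h => hl h.1
      rw [this, mul_zero]
  set g : GL (Fin m) ℂ := ⟨1 + E, 1 - E,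
    by rw [add_mul, mul_sub, mul_sub, one_mul, one_mul, mul_one, hE2]; abel,
    by rw [sub_mul, mul_add, mul_add, one_mul, one_mul, mul_one, hE2]; abel⟩ with hg
  rw [mem_orbitVanishingIdeal_iff, not_forall]
  refine ⟨g, ?_⟩
  rw [aeval_X, formCoeff_apply, linSubstRep_apply]
  change coeff (Finsupp.single iₘ m) (linSubst _ ℂ (1 + E) (chowMonomial ℂ m)) ≠ 0
  rw [← eval_pi_single_of_isHomogeneous
    (linSubst_isHomogeneous _ (chowMonomial_isHomogeneous ℂ m)) iₘ, eval_linSubst, chowMonomial,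
    map_prod]
  have hpt : ∀ x : Fin m,
      (∑ j, (1 + E) j x * (Pi.single iₘ (1 : ℂ) : Fin m → ℂ) j) = 1 := by
    intro x
    rw [Finset.sum_eq_single iₘ (fun j _ hj => by rw [Pi.single_eq_of_ne hj, mul_zero])
      (fun h => absurd (Finset.mem_univ iₘ) h), Pi.single_eq_same, mul_one, Matrix.add_apply,
      hE, Matrix.of_apply, Matrix.one_apply]
    by_cases hx : x = iₘ
    · rw [if_pos hx.symm, if_neg (fun h => h.2 hx), add_zero]
    · rw [if_neg (Ne.symm hx), if_pos ⟨rfl, hx⟩, zero_add]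
  simp only [eval_X, hpt, Finset.prod_const_one]
  exact one_ne_zero

/-- In particular `L ∋ (m,0,…,0) ∈ A(S(Chow_m))`. [cite: BurgisserHuttenhainIkenmeyer2017, Prop. 3 (proof)] -/
theorem single_zero_mem_closure_chowOccWeights (hm : 0 < m) :
    (Pi.single (⟨0, hm⟩ : Fin m) (m : ℤ) : Weight (Fin m)) ∈
      AddSubgroup.closure (chowOccWeights m : Set (Weight (Fin m))) :=
  AddSubgroup.subset_closure (single_zero_mem_chowOccWeights hm)

/-- **Prop. 3 reduced to its generators `λ^{(2)}, …, λ^{(m)}`**: `BHI2017_prop3` follows once, for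
every `m > 2` and every index `1 ≤ k < m` (0-based), the group `A(S(Chow_m))` contains an element
with `k`-th coordinate `1` and vanishing coordinates beyond `k` (in print: `λ^{(2)} = (n-1,1,0,…)`
from the plethysm checks in `Sym^2Sym^2`, `Sym^3Sym^3` and Lemma 5, `λ^{(k)}`, `k ≥ 3`, from
Lemma 6). [cite: BurgisserHuttenhainIkenmeyer2017, Prop. 3 (proof)] -/
theorem BHI2017_prop3_of_generators
    (hgen : ∀ m : ℕ, 2 < m → ∀ k : Fin m, 0 < (k : ℕ) →
      ∃ w ∈ AddSubgroup.closure (chowOccWeights m : Set (Weight (Fin m))),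
        w k = 1 ∧ ∀ i : Fin m, k < i → w i = 0) :
    BHI2017_prop3 := fun m hm =>
  closure_chowOccWeights_eq_bhiLattice_of_generators (fun hm0 => single_zero_mem_chowOccWeights hm0)
    (hgen m hm)

end PropThree

end Literature.Barriers.ValiantsHypothesis
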